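import Literature.AlgebraicGeometry.HodgeTheory.SignSymmetricTransvectionMonodromy
import HarnessLib

/-!
# Sign-symmetric transvection monodromy: ONE seed side suffices
# (the `−` eigenspace is reached through the pairs once `Sp(V₊) × 1` is in the closure)

Family `hodge`, layer `Literature/AlgebraicGeometry/HodgeTheory`; sequel of `SignSymmetricTransvectionMonodromy` (theorems
only, no definition, no named fact).  Written by the prover seat `hodge-nonav-19716-p2` (g9, cell `hodge-nonav`) while
scoping the planner's «hPL‡ ∕ hIRR» re-key of crux K1-B `VeryGeneralSignCommutatorsInHg`
(`Summits/HodgeConjecture/HodgeConjecture/Theses/SignSymmetricPowers.lean`, stmt-HodgeConjecture-19716): it is the algebraic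
step that makes Wall's SIGN RULE at the fixed nodes (which eigenspace a fixed vanishing cycle lies in) unnecessary for
"Theorem A".

`mem_glZariskiClosure_of_signSymmetric` asks, for EACH sign, that the centre set `R_±` contain a FIXED centre whenever it is
non-empty (`hseedPos`, `hseedNeg`): the lines `U_f(K)`, `f = δ ± σδ`, of the paired centres are obtained by propagation from a
fixed centre of the same sign.  Here the `−` seed is dropped:

* `smulRight_add_add_smulRight_sub` — `n_{δ+σδ} + n_{δ−σδ} = 2(n_δ + n_{σδ})` for the nilpotent parts `n_v = ⟨·, v⟩ v`;
* `oneParamTransvection_halves_mul` — `U_{δ+σδ}(s) · U_{δ−σδ}(s) = U_δ(2s) · U_{σδ}(2s)` (`⟨δ, σδ⟩ = 0`, `B` alternating):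
  the pair line `D_{2s}` FACTORS through the two eigen-components of `δ`;
* `oneParamTransvection_mem_of_eigenspace_one` — once the `+` side is closed (`extendAlong_mem_of_connected`), EVERY
  `U_w(c)`, `w ∈ V₊`, lies in the multiplicatively closed `C` (extension by the identity of the transvection of `V₊`);
* **`mem_glZariskiClosure_of_signSymmetric_of_seedPos`** — the main theorem of `SignSymmetricTransvectionMonodromy` WITHOUT
  `hseedNeg`: `U_{δ−σδ}(s) = U_{δ+σδ}(−s) · D_{2s} ∈ C`, so all lines of `R₋` are in `C` directly, and Lemma T on `V₋`
  applies as before.  (By the symmetry `σ ↔ −σ` the `+` seed may equally be traded for a `−` seed.)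

Consequence for the route (recorded in the seat's memo SCOPING-WELIM, not typed here): with fixed centres of UNKNOWN sign
(`σ r = ±r` is automatic for a transvection `U_r(c) ∈ Γ` commuting with `σ`), Theorem A still holds as soon as ONE fixed
centre exists on either side; the parity bookkeeping `Π-node ↦ V₊`, `L-node ↦ V₋` (AGZV II Thm. 5.1 ∕ Wall 1980) is not
needed for the density step.

References: [Deligne1980] P. Deligne, *La conjecture de Weil : II*, Publ. Math. IHÉS 52 (1980), §4.4 (4.4.1)–(4.4.4^α),
pp. 227–228; [GoodmanWallachGTM255] Goodman–Wallach, *Symmetry, Representations, and Invariants*, §11.3.5 Type CII.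
-/

noncomputable section

namespace Literature.AlgebraicGeometry.HodgeTheory

open Literature.AlgebraicGeometry.Motives Literature.LinearAlgebra.Alternating

universe u v

variable {K : Type u} [Field K] {V : Type v} [AddCommGroup V] [Module K V] {B : LinearMap.BilinForm K V}

/-! ## §1 The pair line factors through the eigen-components -/

/-- `n_{a+b} + n_{a−b} = 2(n_a + n_b)` for the nilpotent parts `n_v = ⟨·, v⟩ v` of the transvections.
[cite: Deligne1980, §4.4 Lemme (4.4.3^α) p. 227] -/
theorem smulRight_add_add_smulRight_sub (a b : V) :
    ((B.flip (a + b)).smulRight (a + b) : Module.End K V) + (B.flip (a - b)).smulRight (a - b) =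
      (2 : K) • ((B.flip a).smulRight a + (B.flip b).smulRight b) := by
  ext x
  simp only [LinearMap.add_apply, LinearMap.smulRight_apply, map_add, map_sub,
    LinearMap.sub_apply, smul_add, smul_sub, add_smul, sub_smul, two_smul]
  abel

/-- **The pair line factors**: for `B` alternating and `⟨δ, σδ⟩ = 0`,
`U_{δ+σδ}(s) · U_{δ−σδ}(s) = U_δ(2s) · U_{σδ}(2s)` — the product of the transvections of the two eigen-components
`δ ± σδ` (mutually orthogonal) is the pair line at parameter `2s`. [cite: Deligne1980, §4.4 Lemme (4.4.3^α) p. 227] -/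
theorem oneParamTransvection_halves_mul (hB : B.IsAlt) {σ : V →ₗ[K] V} {δ : V} (h : B δ (σ δ) = 0) (s : K) :
    oneParamTransvection B (δ + σ δ) s * oneParamTransvection B (δ - σ δ) s =
      oneParamTransvection B δ (2 * s) * oneParamTransvection B (σ δ) (2 * s) := by
  have h' : B (σ δ) δ = 0 := by rw [← hB.neg_eq, h, neg_zero]
  have hperp : B (δ + σ δ) (δ - σ δ) = 0 := by
    simp only [map_add, map_sub, LinearMap.add_apply, hB δ, hB (σ δ), h, h']
    abel
  rw [oneParamTransvection_mul_eq_one_add_smul hB hperp, oneParamTransvection_mul_eq_one_add_smul hB h,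
    smulRight_add_add_smulRight_sub, smul_smul, mul_comm s 2]

/-! ## §2 Every transvection of `V₊` is in `C` once the `+` side is closed -/

/-- The restriction of an alternating form to a submodule is alternating. [folklore] -/
private theorem isAlt_restrict (hB : B.IsAlt) (W : Submodule K V) : (B.restrict W).IsAlt := fun x => hB (x : V)

/-- **All transvections along vectors of `V₊` are in `C`** once the hypotheses of the `+` side of
`mem_glZariskiClosure_of_signSymmetric` hold (`R₊ ⊆ L`, `R₊` spanning `V₊` and orthogonally connected): apply
`extendAlong_mem_of_connected` to the isometry `U^{V₊}_w(c)` of `B|V₊` and identify its extension by the identity with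
`U_w(c)` (`extendAlong_oneParamTransvection`). [cite: Deligne1980, §4.4 (4.4.2^α) p. 227] -/
theorem oneParamTransvection_mem_of_eigenspace_one [CharZero K] [FiniteDimensional K V] (hB : B.IsAlt)
    (hBn : B.Nondegenerate) {σ : V →ₗ[K] V} (hσ : σ ^ 2 = 1) (hσB : ∀ x y, B (σ x) (σ y) = B x y)
    {C : Set (Module.End K V)} (hC : ∀ x ∈ C, ∀ y ∈ C, x * y ∈ C) (h1 : (1 : Module.End K V) ∈ C) {R : Set V}
    (hRC : ∀ r ∈ R, ∀ t : K, oneParamTransvection B r t ∈ C)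
    (hspan : Submodule.span K R = Module.End.eigenspace σ 1)
    (hconn : ∀ A ⊆ R, A.Nonempty → A ≠ R → ∃ r ∈ A, ∃ ρ ∈ R, ρ ∉ A ∧ B r ρ ≠ 0)
    (w : Module.End.eigenspace σ 1) (c : K) :
    oneParamTransvection B (w : V) c ∈ C := by
  have hw0 : (B.restrict (Module.End.eigenspace σ 1)) w w = 0 := isAlt_restrict hB _ w
  set e : Module.End.eigenspace σ 1 ≃ₗ[K] Module.End.eigenspace σ 1 :=
    oneParamTransvectionEquiv (B.restrict (Module.End.eigenspace σ 1)) hw0 c with hedef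
  have he : (e : Module.End.eigenspace σ 1 →ₗ[K] Module.End.eigenspace σ 1) =
      oneParamTransvection (B.restrict (Module.End.eigenspace σ 1)) w c :=
    coe_oneParamTransvectionEquiv _ hw0 c
  have hiso : ∀ v v', B.restrict (Module.End.eigenspace σ 1) (e v) (e v') =
      B.restrict (Module.End.eigenspace σ 1) v v' := fun v v' => by
    change B.restrict (Module.End.eigenspace σ 1) ((e : _ →ₗ[K] _) v) ((e : _ →ₗ[K] _) v') = _
    rw [he]
    exact apply_oneParamTransvection_apply _ (isAlt_restrict hB _) w c v v'
  have hmem := extendAlong_mem_of_connected hB hBn hσ hσB hC h1 hRC hspan hconn e hiso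
  rwa [extendAlong_oneParamTransvection hσ hσB w c e he] at hmem

/-! ## §3 The main theorem with one seed -/

/-- **Sign-symmetric transvection monodromy is Zariski-dense in `Sp(V₊) × Sp(V₋)` — one seed side suffices.**  Setting of
`mem_glZariskiClosure_of_signSymmetric` (`char K = 0`, `V` finite-dimensional, `B` alternating non-degenerate, `σ² = 1` a
`B`-isometry, `Γ ≤ GL(V)`, fixed centres `T` and paired centres `D` with `U_r(c) ∈ Γ`, `U_δ(c)U_{σδ}(c) ∈ Γ`, `c ≠ 0`;
`R_± = {r ∈ T | σr = ±r} ∪ {δ ± σδ}` spanning `V_±` and orthogonally connected), but with a fixed centre required only on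
the `+` side (`hseedPos`); NO `−` seed.  Then every `σ`-commuting `B`-isometry lies in `glZariskiClosure Γ`.  Proof: the
`+` side as before gives `Sp(V₊) × 1 ⊆ C`, hence `U_{δ+σδ}(−s) ∈ C` (`oneParamTransvection_mem_of_eigenspace_one`); with
the pair line, `U_{δ−σδ}(s) = U_{δ+σδ}(−s)·U_δ(2s)U_{σδ}(2s) ∈ C` (`oneParamTransvection_halves_mul`); so every line of
`R₋` is in `C` and Lemma T on `V₋` (`extendAlong_mem_of_connected` for `−σ`) finishes.
[cite: Deligne1980, §4.4 Thm (4.4.1), (4.4.2^α)–(4.4.4^α) pp. 227–228] [cite: GoodmanWallachGTM255, §11.3.5 Type CII (11.10)] -/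
theorem mem_glZariskiClosure_of_signSymmetric_of_seedPos [CharZero K] [FiniteDimensional K V] (hB : B.IsAlt)
    (hBn : B.Nondegenerate) {σ : V →ₗ[K] V} (hσ : σ ^ 2 = 1) (hσB : ∀ x y, B (σ x) (σ y) = B x y)
    {Γ : Subgroup (V ≃ₗ[K] V)} {T D : Set V}
    (hT : ∀ r ∈ T, ∃ c : K, c ≠ 0 ∧ oneParamTransvectionEquiv B (hB r) c ∈ Γ)
    (hD : ∀ δ ∈ D, B δ (σ δ) = 0 ∧ ∃ c : K, c ≠ 0 ∧
      oneParamTransvectionEquiv B (hB δ) c * oneParamTransvectionEquiv B (hB (σ δ)) c ∈ Γ)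
    (hspanPos : Submodule.span K ({r ∈ T | σ r = r} ∪ (fun δ => δ + σ δ) '' D) = Module.End.eigenspace σ 1)
    (hconnPos : ∀ A ⊆ {r ∈ T | σ r = r} ∪ (fun δ => δ + σ δ) '' D, A.Nonempty →
      A ≠ {r ∈ T | σ r = r} ∪ (fun δ => δ + σ δ) '' D →
      ∃ r ∈ A, ∃ ρ ∈ {r ∈ T | σ r = r} ∪ (fun δ => δ + σ δ) '' D, ρ ∉ A ∧ B r ρ ≠ 0)
    (hseedPos : ({r ∈ T | σ r = r} ∪ (fun δ => δ + σ δ) '' D).Nonempty → ∃ r ∈ T, σ r = r)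
    (hspanNeg : Submodule.span K ({r ∈ T | σ r = -r} ∪ (fun δ => δ - σ δ) '' D) = Module.End.eigenspace σ (-1))
    (hconnNeg : ∀ A ⊆ {r ∈ T | σ r = -r} ∪ (fun δ => δ - σ δ) '' D, A.Nonempty →
      A ≠ {r ∈ T | σ r = -r} ∪ (fun δ => δ - σ δ) '' D →
      ∃ r ∈ A, ∃ ρ ∈ {r ∈ T | σ r = -r} ∪ (fun δ => δ - σ δ) '' D, ρ ∉ A ∧ B r ρ ≠ 0)
    {g : V ≃ₗ[K] V} (hgσ : ∀ x, g (σ x) = σ (g x)) (hgB : ∀ x y, B (g x) (g y) = B x y) :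
    g ∈ glZariskiClosure Γ := by
  classical
  let b := Module.Free.chooseBasis K V
  set S : Set (Module.End K V) := (fun h : V ≃ₗ[K] V => (h : Module.End K V)) '' (Γ : Set (V ≃ₗ[K] V))
    with hS
  set C := zariskiClosureEndOfBasis b S with hCdef
  have hSmul : ∀ x ∈ S, ∀ y ∈ S, x * y ∈ S := by
    rintro _ ⟨x, hx, rfl⟩ _ ⟨y, hy, rfl⟩
    exact ⟨x * y, Γ.mul_mem hx hy, rfl⟩
  have hC : ∀ x ∈ C, ∀ y ∈ C, x * y ∈ C := fun x hx y hy => mul_mem_zariskiClosureEndOfBasis b hSmul hx hy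
  have h1 : (1 : Module.End K V) ∈ C := subset_zariskiClosureEndOfBasis b S ⟨1, Γ.one_mem, rfl⟩
  have hσσ : ∀ x, σ (σ x) = x := fun x => by rw [← Module.End.mul_apply, ← pow_two, hσ, Module.End.one_apply]
  -- fixed centres and pair lines are in `C`
  have hTC : ∀ r ∈ T, ∀ t : K, oneParamTransvection B r t ∈ C := by
    intro r hr t
    obtain ⟨c, hc, hmem⟩ := hT r hr
    exact oneParamTransvection_mem_closure b (hB r) hc hmem t
  have hDC : ∀ δ ∈ D, B δ (σ δ) = 0 ∧ ∀ s : K, oneParamTransvection B δ s * oneParamTransvection B (σ δ) s ∈ C := by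
    intro δ hδ
    obtain ⟨hδσ, c, hc, hmem⟩ := hD δ hδ
    exact ⟨hδσ, fun s => pairLine_mem_closure hB b hδσ hc hmem s⟩
  -- the `+` side
  have hRpos := forall_oneParamTransvection_mem_of_connected hB two_ne_zero hσ hσB hC
    (fun r hr _ => hTC r hr) hDC hconnPos hseedPos
  have hplus := extendAlong_mem_of_connected hB hBn hσ hσB hC h1 hRpos hspanPos hconnPos (restrictAlong g hgσ)
    (restrictAlong_mem_isometries (B := B) (σ := σ) ⟨hgσ, hgB⟩)
  -- every transvection of `V₊` is in `C`
  have hVpos : ∀ (w : Module.End.eigenspace σ 1) (c : K), oneParamTransvection B (w : V) c ∈ C :=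
    fun w c => oneParamTransvection_mem_of_eigenspace_one hB hBn hσ hσB hC h1 hRpos hspanPos hconnPos w c
  -- the `-` side: all lines of `R₋` are in `C`, the paired ones through the pair line and the `+` component
  have hσ' : (-σ) ^ 2 = 1 := neg_sq_eq_one hσ
  have hσB' : ∀ x y, B ((-σ) x) ((-σ) y) = B x y := fun x y => by
    simp only [LinearMap.neg_apply, map_neg, neg_neg, hσB]
  have hgσ' : ∀ x, g ((-σ) x) = (-σ) (g x) := comm_neg hgσ
  have hsetT : {r ∈ T | (-σ) r = r} = {r ∈ T | σ r = -r} := by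
    ext r
    simp only [Set.mem_setOf_eq, LinearMap.neg_apply, neg_eq_iff_eq_neg]
  have hsetD : (fun δ => δ + (-σ) δ) '' D = (fun δ => δ - σ δ) '' D := by
    refine Set.image_congr fun δ _ => ?_
    rw [LinearMap.neg_apply, sub_eq_add_neg]
  have hRneg : ∀ ρ ∈ {r ∈ T | (-σ) r = r} ∪ (fun δ => δ + (-σ) δ) '' D, ∀ t : K, oneParamTransvection B ρ t ∈ C := by
    rw [hsetT, hsetD]
    rintro ρ (⟨hρT, -⟩ | ⟨δ, hδ, rfl⟩) t
    · exact hTC ρ hρT t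
    · obtain ⟨hδσ, hpair⟩ := hDC δ hδ
      have hplusmem : δ + σ δ ∈ Module.End.eigenspace σ 1 := by
        rw [Module.End.mem_eigenspace_iff, one_smul, map_add, hσσ, add_comm]
      have hfac : oneParamTransvection B (δ - σ δ) t =
          oneParamTransvection B (δ + σ δ) (-t) *
            (oneParamTransvection B δ (2 * t) * oneParamTransvection B (σ δ) (2 * t)) := by
        rw [← oneParamTransvection_halves_mul hB hδσ t, ← mul_assoc,
          show oneParamTransvection B (δ + σ δ) (-t) * oneParamTransvection B (δ + σ δ) t = 1 from by
            rw [Module.End.mul_eq_comp, oneParamTransvection_comp B (hB _), neg_add_cancel,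
              oneParamTransvection_zero]; rfl,
          one_mul]
      rw [hfac]
      exact hC _ (hVpos ⟨δ + σ δ, hplusmem⟩ (-t)) _ (hpair (2 * t))
  have hspanNeg' : Submodule.span K ({r ∈ T | (-σ) r = r} ∪ (fun δ => δ + (-σ) δ) '' D) =
      Module.End.eigenspace (-σ) 1 := by
    rw [hsetT, hsetD, hspanNeg, eigenspace_neg_one]
  have hminus := extendAlong_mem_of_connected hB hBn hσ' hσB' hC h1 hRneg hspanNeg'
    (by rw [hsetT, hsetD]; exact hconnNeg) (restrictAlong g hgσ')
    (restrictAlong_mem_isometries (B := B) (σ := -σ) ⟨hgσ', hgB⟩)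
  -- assemble `g = (g|V₊ ⊕ 1)(1 ⊕ g|V₋)`
  have hfac := extendAlong_restrictAlong_mul two_ne_zero hσ g hgσ hgσ'
  rw [mem_glZariskiClosure_iff, ← zariskiClosureEnd_basis_indep b, ← hS, ← hCdef, ← hfac,
    LinearEquiv.coe_toLinearMap_mul]
  exact hC _ hplus _ hminus

/-! ## §4 (appended) A transvection commuting with `σ` has its centre in an eigenspace — no sign rule needed -/

/-- **Fixed centres sort themselves into the eigenspaces.**  If `B` is non-degenerate, `σ² = 1` (no isometry hypothesis
needed) and the transvection `U_r(c)`, `c ≠ 0`, COMMUTES with `σ` (for the monodromy group of an `ι`-equivariant family every rational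
transport commutes with `ι^*`), then `σ r = r` or `σ r = −r`: indeed `σ U_r(c) σ⁻¹ = U_{σr}(c)`, so `⟨x, r⟩ σr = ⟨σx, r⟩ r`
for all `x`, whence `σ r = λ r` and `λ² = 1`.  (WHICH sign — Wall's theorem, AGZV II Thm. 5.1 — is not decided here and is
not needed by `mem_glZariskiClosure_of_signSymmetric_of_seedPos`.) [cite: Deligne1980, §4.4 (4.4.2^α) p. 227] -/
theorem eq_or_eq_neg_of_oneParamTransvection_comm (hBn : B.Nondegenerate) {σ : V →ₗ[K] V} (hσ : σ ^ 2 = 1)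
    {r : V} {c : K} (hc : c ≠ 0)
    (hcomm : ∀ x, oneParamTransvection B r c (σ x) = σ (oneParamTransvection B r c x)) :
    σ r = r ∨ σ r = -r := by
  have hσσ : ∀ x, σ (σ x) = x := fun x => by rw [← Module.End.mul_apply, ← pow_two, hσ, Module.End.one_apply]
  -- `⟨σ x, r⟩ r = ⟨x, r⟩ σ r` for all `x`
  have hkey : ∀ x, (B (σ x) r) • r = (B x r) • σ r := by
    intro x
    have h := hcomm x
    rw [oneParamTransvection_apply, oneParamTransvection_apply, map_add, map_smul, add_right_inj, mul_smul, mul_smul]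
      at h
    exact smul_right_injective V hc h
  by_cases hr : r = 0
  · left; rw [hr, map_zero]
  -- a vector pairing non-trivially with `r`
  obtain ⟨x, hx⟩ : ∃ x, B x r ≠ 0 := by
    by_contra h0
    push Not at h0
    exact hr (hBn.2 r h0)
  -- `σ r = λ r` with `λ = ⟨σx, r⟩ / ⟨x, r⟩`, and `λ² = 1`
  set lam : K := B (σ x) r / B x r with hlam
  have hσr : σ r = lam • r := by
    have h := hkey x
    rw [hlam, div_eq_mul_inv, mul_comm, mul_smul, h, smul_smul, inv_mul_cancel₀ hx, one_smul]
  have hlam2 : lam * lam = 1 := by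
    have h : r = (lam * lam) • r := by
      conv_lhs => rw [← hσσ r, hσr, map_smul, hσr, smul_smul]
    have h' : (lam * lam - 1) • r = 0 := by rw [sub_smul, one_smul, ← h, sub_self]
    rcases smul_eq_zero.1 h' with h'' | h''
    · exact (sub_eq_zero.1 h'')
    · exact absurd h'' hr
  rcases mul_self_eq_one_iff.1 hlam2 with h1 | h1
  · left; rw [hσr, h1, one_smul]
  · right; rw [hσr, h1, neg_one_smul]

/-! ## §5 (appended) Seed on EITHER side: fixed centres that are eigenvectors, at least one if there are pairs -/

/-- **Sign-symmetric density with fixed centres of UNKNOWN sign.**  Setting as before, but the seed hypotheses are replaced by: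
every fixed centre is a `σ`-eigenvector (`σ r = ±r` — automatic for a transvection in a `σ`-commuting `Γ`,
`eq_or_eq_neg_of_oneParamTransvection_comm`) and, if there are paired centres, there is at least one fixed centre (of whichever
sign).  Then every `σ`-commuting `B`-isometry lies in `glZariskiClosure Γ` (apply the one-seed theorem to `σ` if some fixed centre
is in `V₊`, else to `−σ`). [cite: Deligne1980, §4.4 Thm (4.4.1), (4.4.2^α)–(4.4.4^α) pp. 227–228] -/
theorem mem_glZariskiClosure_of_signSymmetric_of_eigenCentres [CharZero K] [FiniteDimensional K V] (hB : B.IsAlt)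
    (hBn : B.Nondegenerate) {σ : V →ₗ[K] V} (hσ : σ ^ 2 = 1) (hσB : ∀ x y, B (σ x) (σ y) = B x y)
    {Γ : Subgroup (V ≃ₗ[K] V)} {T D : Set V}
    (hT : ∀ r ∈ T, ∃ c : K, c ≠ 0 ∧ oneParamTransvectionEquiv B (hB r) c ∈ Γ)
    (hD : ∀ δ ∈ D, B δ (σ δ) = 0 ∧ ∃ c : K, c ≠ 0 ∧
      oneParamTransvectionEquiv B (hB δ) c * oneParamTransvectionEquiv B (hB (σ δ)) c ∈ Γ)
    (hTsign : ∀ r ∈ T, σ r = r ∨ σ r = -r) (hseed : D.Nonempty → T.Nonempty)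
    (hspanPos : Submodule.span K ({r ∈ T | σ r = r} ∪ (fun δ => δ + σ δ) '' D) = Module.End.eigenspace σ 1)
    (hconnPos : ∀ A ⊆ {r ∈ T | σ r = r} ∪ (fun δ => δ + σ δ) '' D, A.Nonempty →
      A ≠ {r ∈ T | σ r = r} ∪ (fun δ => δ + σ δ) '' D →
      ∃ r ∈ A, ∃ ρ ∈ {r ∈ T | σ r = r} ∪ (fun δ => δ + σ δ) '' D, ρ ∉ A ∧ B r ρ ≠ 0)
    (hspanNeg : Submodule.span K ({r ∈ T | σ r = -r} ∪ (fun δ => δ - σ δ) '' D) = Module.End.eigenspace σ (-1))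
    (hconnNeg : ∀ A ⊆ {r ∈ T | σ r = -r} ∪ (fun δ => δ - σ δ) '' D, A.Nonempty →
      A ≠ {r ∈ T | σ r = -r} ∪ (fun δ => δ - σ δ) '' D →
      ∃ r ∈ A, ∃ ρ ∈ {r ∈ T | σ r = -r} ∪ (fun δ => δ - σ δ) '' D, ρ ∉ A ∧ B r ρ ≠ 0)
    {g : V ≃ₗ[K] V} (hgσ : ∀ x, g (σ x) = σ (g x)) (hgB : ∀ x y, B (g x) (g y) = B x y) :
    g ∈ glZariskiClosure Γ := by
  by_cases hpos : ∃ r ∈ T, σ r = r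
  · exact mem_glZariskiClosure_of_signSymmetric_of_seedPos hB hBn hσ hσB hT hD hspanPos hconnPos (fun _ => hpos)
      hspanNeg hconnNeg hgσ hgB
  · -- no fixed centre in `V₊`: every fixed centre is in `V₋`; run the one-seed theorem for `−σ`
    push Not at hpos
    have hσ' : (-σ) ^ 2 = 1 := neg_sq_eq_one hσ
    have hσB' : ∀ x y, B ((-σ) x) ((-σ) y) = B x y := fun x y => by
      simp only [LinearMap.neg_apply, map_neg, neg_neg, hσB]
    have hgσ' : ∀ x, g ((-σ) x) = (-σ) (g x) := comm_neg hgσ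
    have hsetT : {r ∈ T | (-σ) r = r} = {r ∈ T | σ r = -r} := by
      ext r
      simp only [Set.mem_setOf_eq, LinearMap.neg_apply, neg_eq_iff_eq_neg]
    have hsetT' : {r ∈ T | (-σ) r = -r} = {r ∈ T | σ r = r} := by
      ext r
      simp only [Set.mem_setOf_eq, LinearMap.neg_apply, neg_inj]
    have hsetD : (fun δ => δ + (-σ) δ) '' D = (fun δ => δ - σ δ) '' D := by
      refine Set.image_congr fun δ _ => ?_
      rw [LinearMap.neg_apply, sub_eq_add_neg]
    have hsetD' : (fun δ => δ - (-σ) δ) '' D = (fun δ => δ + σ δ) '' D := by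
      refine Set.image_congr fun δ _ => ?_
      rw [LinearMap.neg_apply, sub_neg_eq_add]
    have hD' : ∀ δ ∈ D, B δ ((-σ) δ) = 0 ∧ ∃ c : K, c ≠ 0 ∧
        oneParamTransvectionEquiv B (hB δ) c * oneParamTransvectionEquiv B (hB ((-σ) δ)) c ∈ Γ := by
      intro δ hδ
      obtain ⟨h0, c, hc, hmem⟩ := hD δ hδ
      refine ⟨by rw [LinearMap.neg_apply, map_neg, h0, neg_zero], c, hc, ?_⟩
      have e : oneParamTransvectionEquiv B (hB ((-σ) δ)) c = oneParamTransvectionEquiv B (hB (σ δ)) c := by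
        apply LinearEquiv.toLinearMap_injective
        rw [coe_oneParamTransvectionEquiv, coe_oneParamTransvectionEquiv, LinearMap.neg_apply,
          ← neg_one_smul K (σ δ), oneParamTransvection_smul, mul_assoc, neg_one_mul, neg_neg, mul_one]
      rw [e]
      exact hmem
    have hseedNeg' : ({r ∈ T | (-σ) r = r} ∪ (fun δ => δ + (-σ) δ) '' D).Nonempty → ∃ r ∈ T, (-σ) r = r := by
      rw [hsetT, hsetD]
      rintro ⟨ρ, hρ⟩
      rcases hρ with ⟨hρT, hρσ⟩ | ⟨δ, hδ, -⟩
      · exact ⟨ρ, hρT, by rw [LinearMap.neg_apply, hρσ, neg_neg]⟩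
      · obtain ⟨r, hr⟩ := hseed ⟨δ, hδ⟩
        rcases hTsign r hr with h | h
        · exact absurd h (hpos r hr)
        · exact ⟨r, hr, by rw [LinearMap.neg_apply, h, neg_neg]⟩
    have hmem := mem_glZariskiClosure_of_signSymmetric_of_seedPos hB hBn hσ' hσB' hT hD'
      (by rw [hsetT, hsetD, hspanNeg, eigenspace_neg_one]) (by rw [hsetT, hsetD]; exact hconnNeg) hseedNeg'
      (by rw [hsetT', hsetD', hspanPos, ← eigenspace_neg_one, neg_neg]) (by rw [hsetT', hsetD']; exact hconnPos) hgσ' hgB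
    exact hmem

end Literature.AlgebraicGeometry.HodgeTheory

end
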